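import Mathlib
import HarnessLib

/-!
# ValiantsHypothesis / LacunarySymmetroid — crux `MatrixDescartes` (stmt-ValiantsHypothesis-18050, V1),
# LINE (A) `Cruxes/MatrixDescartes/Lines/product_plus_one.lean` (val-idea-25 g0; director R266 (A) / R268 (2), desk RULING #296 (a)):
# stub S0 `stub_windowArith` — WINDOW ARITHMETIC (prover #1 = val-lit-p5 g13)

The line's head is `productPlusOneMDR_of : WindowArith → PPOPolyLaw → ProductPlusOneMDR`: a class law polynomial in `mK`
(`PPOPolyLaw`, the content, OPEN) gives the restricted V1 once one knows that, throughout MDR's quasi-polynomial window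
`m ≤ 2^((⌊log₂K⌋+c)^c)`, the quantity `((mK+2)^C)^q` is eventually `≤ 2^(K⌊log₂K⌋)`.  That is this file:

* `exists_poly_le_two_pow` — `A·((L+c)^c + L + 2) ≤ 2^L` for all large `L` (Mathlib `tendsto_pow_const_div_const_pow_of_one_lt`);
* `windowArith (C c q) : ∃ K₀, ∀ K m, K₀ ≤ K → m ≤ 2^((log₂K+c)^c) → ((mK+2)^C)^q ≤ 2^(K log₂K)` (with `L = ⌊log₂K⌋`:
  `mK+2 ≤ 2^((L+c)^c + L + 2)`, so the exponent to beat is `Cq·((L+c)^c + L + 2) ≤ 2^L ≤ K ≤ K·L`);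
* ★ `windowArith_holds` — the line's `WindowArith` VERBATIM (`∀ C c q, 0 < q → ∃ K₀, …`; the `0 < q` binder is idle), so the line
  owner wires `theorem stub_windowArith : WindowArith := Theorems.…ProductPlusOne.windowArith_holds` by δ-unfolding only.

Honest framing: pure arithmetic (the S-sized stub of an ON-PATH NECESSARY-SIDE rung of V1); the class law `PPOPolyLaw` /
`ProductPlusOneMDR`, `MatrixDescartes`, Conjecture B are OPEN; `VP ≠ VNP` is NOT proved.  No definitions, no named facts.
-/

set_option linter.dupNamespace false

namespace Summit.ValiantsHypothesis.ValiantsHypothesis.Theorems.LacunarySymmetroidMatrixDescartes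

namespace ProductPlusOne

open Filter Topology

/-- Polynomial versus exponential: `A·((L+c)^c + L + 2) ≤ 2^L` for all large `L`. [folklore] -/
theorem exists_poly_le_two_pow (A c : ℕ) : ∃ L₀ : ℕ, ∀ L : ℕ, L₀ ≤ L → A * ((L + c) ^ c + L + 2) ≤ 2 ^ L := by
  -- `A·((L+c)^c + L + 2) ≤ 3A·(L+c+2)^(c+1)` and `n^(c+1)/2^n → 0` (real analysis), read at `n = L + c + 2`.
  have ht : Tendsto (fun n : ℕ => ((n : ℝ) ^ (c + 1)) / (2 : ℝ) ^ n) atTop (𝓝 0) :=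
    tendsto_pow_const_div_const_pow_of_one_lt (c + 1) (by norm_num : (1 : ℝ) < 2)
  have hev : ∀ᶠ n : ℕ in atTop, ((n : ℝ) ^ (c + 1)) / (2 : ℝ) ^ n ≤ 1 / (A * 3 * 2 ^ (c + 2) + 1 : ℝ) := by
    have hpos : (0 : ℝ) < 1 / (A * 3 * 2 ^ (c + 2) + 1 : ℝ) := by positivity
    exact (ht.eventually (ge_mem_nhds hpos))
  obtain ⟨N, hN⟩ := eventually_atTop.1 hev
  refine ⟨N, fun L hL => ?_⟩
  have hn := hN (L + c + 2) (by omega)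
  -- clear denominators
  have h2pos : (0 : ℝ) < (2 : ℝ) ^ (L + c + 2) := by positivity
  have hB : (0 : ℝ) < (A * 3 * 2 ^ (c + 2) + 1 : ℝ) := by positivity
  rw [div_le_div_iff₀ h2pos hB, one_mul] at hn
  -- `hn : (L+c+2)^(c+1) * (A*3*2^(c+2)+1) ≤ 2^(L+c+2)`
  have key : (A : ℝ) * (((L + c : ℕ) : ℝ) ^ c + L + 2) ≤ (2 : ℝ) ^ L := by
    have hx : (1 : ℝ) ≤ ((L + c + 2 : ℕ) : ℝ) := by exact_mod_cast (by omega : 1 ≤ L + c + 2)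
    have hx0 : (0 : ℝ) ≤ ((L + c + 2 : ℕ) : ℝ) := by positivity
    -- `(L+c)^c + L + 2 ≤ 3 (L+c+2)^(c+1)`
    have h1 : (((L + c : ℕ) : ℝ) ^ c + L + 2) ≤ 3 * ((L + c + 2 : ℕ) : ℝ) ^ (c + 1) := by
      have ha : ((L + c : ℕ) : ℝ) ^ c ≤ ((L + c + 2 : ℕ) : ℝ) ^ (c + 1) := by
        calc ((L + c : ℕ) : ℝ) ^ c ≤ ((L + c + 2 : ℕ) : ℝ) ^ c :=
              pow_le_pow_left₀ (by positivity) (by exact_mod_cast (by omega : L + c ≤ L + c + 2)) c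
          _ ≤ ((L + c + 2 : ℕ) : ℝ) ^ (c + 1) := pow_le_pow_right₀ hx (by omega)
      have hb : (L : ℝ) + 2 ≤ ((L + c + 2 : ℕ) : ℝ) ^ (c + 1) := by
        calc (L : ℝ) + 2 ≤ ((L + c + 2 : ℕ) : ℝ) := by push_cast; linarith [(Nat.cast_nonneg c : (0:ℝ) ≤ c)]
          _ = ((L + c + 2 : ℕ) : ℝ) ^ 1 := (pow_one _).symm
          _ ≤ ((L + c + 2 : ℕ) : ℝ) ^ (c + 1) := pow_le_pow_right₀ hx (by omega)
      linarith
    have hA0 : (0 : ℝ) ≤ A := Nat.cast_nonneg A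
    have hXc : (0 : ℝ) ≤ ((L + c + 2 : ℕ) : ℝ) ^ (c + 1) := by positivity
    have h3 : (A : ℝ) * 3 * ((L + c + 2 : ℕ) : ℝ) ^ (c + 1) * 2 ^ (c + 2) ≤ (2 : ℝ) ^ L * 2 ^ (c + 2) := by
      calc (A : ℝ) * 3 * ((L + c + 2 : ℕ) : ℝ) ^ (c + 1) * 2 ^ (c + 2)
          = ((A : ℝ) * 3 * 2 ^ (c + 2)) * ((L + c + 2 : ℕ) : ℝ) ^ (c + 1) := by ring
        _ ≤ ((A : ℝ) * 3 * 2 ^ (c + 2) + 1) * ((L + c + 2 : ℕ) : ℝ) ^ (c + 1) := by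
            apply mul_le_mul_of_nonneg_right _ hXc; linarith
        _ = ((L + c + 2 : ℕ) : ℝ) ^ (c + 1) * ((A : ℝ) * 3 * 2 ^ (c + 2) + 1) := by ring
        _ ≤ (2 : ℝ) ^ (L + c + 2) := hn
        _ = (2 : ℝ) ^ L * 2 ^ (c + 2) := by rw [show L + c + 2 = L + (c + 2) by ring, pow_add]
    have h4 : (A : ℝ) * 3 * ((L + c + 2 : ℕ) : ℝ) ^ (c + 1) ≤ (2 : ℝ) ^ L :=
      le_of_mul_le_mul_right h3 (by positivity)
    calc (A : ℝ) * (((L + c : ℕ) : ℝ) ^ c + L + 2) ≤ A * (3 * ((L + c + 2 : ℕ) : ℝ) ^ (c + 1)) :=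
          mul_le_mul_of_nonneg_left h1 hA0
      _ = (A : ℝ) * 3 * ((L + c + 2 : ℕ) : ℝ) ^ (c + 1) := by ring
      _ ≤ (2 : ℝ) ^ L := h4
  exact_mod_cast key

/-- **Window arithmetic**: a polynomial class law inside MDR's quasi-polynomial window beats the rate `2^(K log₂ K)` eventually.
[folklore] -/
theorem windowArith (C c q : ℕ) : ∃ K₀ : ℕ, ∀ K m : ℕ, K₀ ≤ K → m ≤ 2 ^ ((Nat.log 2 K + c) ^ c) →
    ((m * K + 2) ^ C) ^ q ≤ 2 ^ (K * Nat.log 2 K) := by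
  obtain ⟨L₀, hL₀⟩ := exists_poly_le_two_pow (C * q) c
  refine ⟨2 ^ (L₀ + 1), fun K m hK hm => ?_⟩
  set L := Nat.log 2 K with hL
  have hKpos : 0 < K := lt_of_lt_of_le (by positivity) hK
  have hK1 : 1 < K := lt_of_lt_of_le (by
    have : 2 ≤ 2 ^ (L₀ + 1) := by
      calc 2 = 2 ^ 1 := by norm_num
        _ ≤ 2 ^ (L₀ + 1) := Nat.pow_le_pow_right (by norm_num) (by omega)
    omega) hK
  -- `L₀ + 1 ≤ L` and `K < 2^(L+1)`, `2^L ≤ K`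
  have hLge : L₀ + 1 ≤ L := by
    rw [hL]
    exact Nat.le_log_of_pow_le (by norm_num) hK
  have hKlt : K < 2 ^ (L + 1) := Nat.lt_pow_succ_log_self (by norm_num) K
  have hKge : 2 ^ L ≤ K := Nat.pow_log_le_self 2 hKpos.ne'
  -- `m K + 2 ≤ 2 ^ ((L+c)^c + L + 2)`
  have hbase : m * K + 2 ≤ 2 ^ ((L + c) ^ c + L + 2) := by
    have h1 : m * K ≤ 2 ^ ((L + c) ^ c) * 2 ^ (L + 1) := Nat.mul_le_mul hm hKlt.le
    have h2 : 2 ≤ 2 ^ ((L + c) ^ c + L + 1) := by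
      calc 2 = 2 ^ 1 := by norm_num
        _ ≤ 2 ^ ((L + c) ^ c + L + 1) := Nat.pow_le_pow_right (by norm_num) (by omega)
    calc m * K + 2 ≤ 2 ^ ((L + c) ^ c) * 2 ^ (L + 1) + 2 ^ ((L + c) ^ c + L + 1) := Nat.add_le_add h1 h2
      _ = 2 ^ ((L + c) ^ c + L + 2) := by rw [← pow_add]; ring
  -- exponent bookkeeping
  have hexp : C * q * ((L + c) ^ c + L + 2) ≤ K * L := by
    have h := hL₀ L (by omega)
    calc C * q * ((L + c) ^ c + L + 2) ≤ 2 ^ L := h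
      _ ≤ K := hKge
      _ ≤ K * L := Nat.le_mul_of_pos_right K (by omega)
  calc ((m * K + 2) ^ C) ^ q = (m * K + 2) ^ (C * q) := by rw [← pow_mul]
    _ ≤ (2 ^ ((L + c) ^ c + L + 2)) ^ (C * q) := Nat.pow_le_pow_left hbase _
    _ = 2 ^ (C * q * ((L + c) ^ c + L + 2)) := by rw [← pow_mul, mul_comm]
    _ ≤ 2 ^ (K * L) := Nat.pow_le_pow_right (by norm_num) hexp

/-- ★ **`stub_windowArith` of LINE (A) `product_plus_one`, VERBATIM** (the line's `WindowArith`, binder for binder; the hypothesis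
`0 < q` is not needed). [folklore] -/
theorem windowArith_holds :
    ∀ C c q : ℕ, 0 < q → ∃ K₀ : ℕ, ∀ K m : ℕ, K₀ ≤ K → m ≤ 2 ^ ((Nat.log 2 K + c) ^ c) →
      ((m * K + 2) ^ C) ^ q ≤ 2 ^ (K * Nat.log 2 K) :=
  fun C c q _ => windowArith C c q

end ProductPlusOne

end Summit.ValiantsHypothesis.ValiantsHypothesis.Theorems.LacunarySymmetroidMatrixDescartes
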